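import Literature.NumberTheory.LFunctions.WeilResolventVector
import Literature.NumberTheory.LFunctions.WeilGroundStateRealZerosProofs
import HarnessLib

/-!
# Shifted-resolvent vectors of the truncated Weil form: existence, uniqueness, value at `1/2`,
# symmetry

Sibling proof file of `Literature/NumberTheory/LFunctions/WeilResolventVector.lean` (same
normalisation; `J_λ = weilResolventFunctional lam`, `ε(a) = weilGroundEnergy a`,
`IsWeilResolventVector a lam v`). Everything here is proved; there are no named facts and no new
definitions. It supplies, for a shift STRICTLY BELOW THE BOTTOM, `λ < ε(a)`, the functional
analysis promised in the module docstring of `WeilResolventVector.lean`, carried out inside `L²`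
without positing the operator `A_a` or the completion `H(T_{a,λ})`:

* §1–2 `integral_norm_sq_sub_le_of_le_weilResolventFunctional` — the KEY INEQUALITY: for window
  test functions `g, g'` and any lower bound `m` of `J_λ` on the window,
  `(ε(a) − λ) ∫ |g − g'|² ≤ 2 (J_λ(g) + J_λ(g') − 2m)`. It is the parallelogram law for `J_λ`
  (`weilResolventFunctional_add_add_sub`: `J(f + h) + J(f − h) = 2 J(f) + 2 q_λ(h)`,
  `q_λ = Re Q − λ‖·‖²`) at `f = ½(g + g')`, `h = ½(g − g')`, combined with the coercivity
  `q_λ(h) ≥ (ε(a) − λ) ‖h‖₂²` (`weilGroundEnergy_mul_le_re`). This is the strict convexity behind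
  the Riesz / Lax–Milgram step of Kato VI §2.1 (proof of Thm. 2.1) for the norm
  `‖·‖_{T_{a,λ}}` of Suzuki 2026 §1.2 (1.9).
* §3 `IsWeilResolventVector.ae_eq` — UNIQUENESS a.e.: two shifted-resolvent vectors for the same
  `a` and `λ < ε(a)` agree a.e. (their minimising sequences are mutually `L²`-close).
* §4 `exists_isWeilResolventVector` — EXISTENCE for every real `a` and `λ < ε(a)`: `J_λ` is
  bounded below on the window (`bddBelow_weilResolventFunctional`: `J_λ ≥ −C²/(ε(a) − λ)` by
  Cauchy–Schwarz `|ĝ(1/2)| ≤ C ‖g‖₂`), a minimising sequence exists (`exists_seq_tendsto_sInf`), it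
  is `L²`-Cauchy by the key inequality, and `L²(ℝ)` is complete (`MeasureTheory.Lp`).
* §5 `IsWeilResolventVector.re_weilMellin_half` — THE VALUE AT `1/2`:
  `Re v̂(1/2) = −weilResolventInf a λ` (`= ‖v‖²_T = ⟨(A_a − λ)⁻¹ 1, 1⟩` in operator language), the
  Euler–Lagrange identity along the minimising sequence; `weilResolventInf_neg` /
  `.re_weilMellin_half_pos`: for `a > 0` the infimum is `< 0`, so `Re v̂(1/2) > 0`.
* §6–7 SYMMETRY: `J_λ` is invariant under `g ↦ ḡ` and `g ↦ g(−·)` (Weil's distribution is real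
  and even: `Q(ḡ) = Q(g)`, `weilQuadratic_conj`, via the kernel identity `ḡ ⋆ (ḡ)̃ = (g ⋆ g̃)(−·)`
  and parity of `W`), so the shifted-resolvent vectors are stable under both involutions
  (`IsWeilResolventVector.conj_comp`, `.comp_neg`); with uniqueness, every shifted-resolvent
  vector below the bottom is a.e. real and a.e. even, and averaging gives a pointwise real, even
  representative: `exists_isWeilResolventVector_real_even`, and with `0 < Re v̂(1/2)` for `a > 0`,
  `exists_isWeilResolventVector_real_even_pos` — the (correctly parenthesised) shape of route item
  `ResolventVectorExists` of `RiemannHypothesis/ShiftedResolvent`.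

Design note: the reflection invariance of `W` and `Q` is public API of
`Literature/NumberTheory/LFunctions/WeilWindowSimpleEven.lean`, which cannot be imported next to
the `WeilGroundStateRealZeros` cone used here (both declare
`Literature.NumberTheory.LFunctions.WeilWindowSimpleEven`); as in
`WeilGroundStateRealZerosProofs.lean` §0 the seven short reflection lemmas are PRIVATE verbatim
copies (§6).

## References

* M. Suzuki, *Weil's quadratic form via the screw function* (2026), arXiv:2606.09096, §1.2
  eq. (1.9) (`T_{a,λ} = A_a − λI` is positive for `λ < λ_a`; the norm `‖·‖_{T_a}` and `H(T_a)`).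
* T. Kato, *Perturbation theory for linear operators* (1966), VI §2.1, proof of Thm. 2.1 (the
  resolvent of the operator of a closed form by the Riesz representation theorem in `H_t`).
* E. Bombieri, *Remarks on Weil's quadratic functional in the theory of prime numbers I*, Rend.
  Mat. Acc. Lincei (9) 11 (2000), §4, Thm. 3 (minimising sequences of the variational problems on
  `L²(E)` converge strongly in `L²`).
* A. Connes, W. D. van Suijlekom, *Quadratic Forms, Real Zeros and Echoes of the Spectral
  Action*, Comm. Math. Phys. 406 (2025), arXiv:2511.23257, §4 (the even distribution), Thm. 6.1.
-/

noncomputable section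

open Complex Filter Set MeasureTheory
open scoped Real Topology ENNReal ComplexConjugate

namespace Literature.NumberTheory.LFunctions

open ConnesVanSuijlekom

/-! ## §1. Algebra of the Dirichlet functional on test functions -/

section Algebra

variable {lam : ℝ} {f g h : ℝ → ℂ}

/-- **Homogeneity along real rays**: `J_λ(t g) = t² q_λ(g) − 2t Re ĝ(1/2)` for real `t`
(`Q(c g) = |c|² Q(g)`, `(c g)^ = c ĝ`). [folklore] -/
theorem weilResolventFunctional_real_mul (lam t : ℝ) (g : ℝ → ℂ) :
    weilResolventFunctional lam (fun x ↦ (t : ℂ) * g x) =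
      t ^ 2 * ((weilQuadratic g).re - lam * ∫ x, ‖g x‖ ^ 2) -
        2 * t * (weilMellin g (1 / 2)).re := by
  simp only [weilResolventFunctional]
  rw [weilQuadratic_const_mul, weilMellin_const_mul, Complex.normSq_ofReal, Complex.re_ofReal_mul,
    Complex.re_ofReal_mul]
  have hN : ∫ x, ‖(t : ℂ) * g x‖ ^ 2 = t ^ 2 * ∫ x, ‖g x‖ ^ 2 := by
    simp only [norm_mul, mul_pow, Complex.norm_real, Real.norm_eq_abs, sq_abs]
    exact integral_const_mul _ _
  rw [hN]
  ring

/-- **Parallelogram law for the Dirichlet functional** on test functions: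
`J_λ(f + h) + J_λ(f − h) = 2 J_λ(f) + 2 q_λ(h)` with `q_λ(h) = Re Q(h) − λ ∫ |h|²` (the linear
term `−2 Re ĥ(1/2)` cancels; `Q` and `‖·‖²` are hermitian forms). (Kato VI §2.1: `H_t` is a
pre-Hilbert space for `(u, v)_t`.) [cite: Kato1966, VI §2.1 (proof of Thm. 2.1)] -/
theorem weilResolventFunctional_add_add_sub (lam : ℝ) (hf : IsWeilTest f) (hh : IsWeilTest h) :
    weilResolventFunctional lam (f + h) + weilResolventFunctional lam (f - h) =
      2 * weilResolventFunctional lam f +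
        2 * ((weilQuadratic h).re - lam * ∫ x, ‖h x‖ ^ 2) := by
  have e1 : (f + fun x ↦ ((1 : ℝ) : ℂ) * h x) = f + h := by
    funext x; simp
  have e2 : (f + fun x ↦ ((-1 : ℝ) : ℂ) * h x) = f - h := by
    funext x; simp [sub_eq_add_neg]
  have hQ1 := re_weilQuadratic_add_real_mul hf hh 1
  have hQ2 := re_weilQuadratic_add_real_mul hf hh (-1)
  have hN1 := integral_norm_sq_add_real_mul hf hh 1
  have hN2 := integral_norm_sq_add_real_mul hf hh (-1)
  rw [e1] at hQ1 hN1
  rw [e2] at hQ2 hN2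
  have hM1 : weilMellin (f + h) (1 / 2) = weilMellin f (1 / 2) + weilMellin h (1 / 2) :=
    weilMellin_add hf.1.continuous hf.2 hh.1.continuous hh.2 _
  have hM2 : weilMellin (f - h) (1 / 2) = weilMellin f (1 / 2) - weilMellin h (1 / 2) := by
    rw [← e2, weilMellin_add hf.1.continuous hf.2 (hh.const_mul _).1.continuous
      (hh.const_mul _).2, weilMellin_const_mul]
    push_cast
    ring
  unfold weilResolventFunctional
  rw [hQ1, hQ2, hN1, hN2, hM1, hM2]
  simp only [Complex.add_re, Complex.sub_re]
  ring

end Algebra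

/-! ## §2. The key inequality: strict convexity of `J_λ` below the bottom -/

section Key

variable {a lam m : ℝ} {g g' : ℝ → ℂ}

/-- **Key inequality.** For `λ < ε(a)`, window test functions `g, g'` and any lower bound `m` of
`J_λ` on the window, `(ε(a) − λ) ∫ |g − g'|² ≤ 2 (J_λ(g) + J_λ(g') − 2m)`: apply the
parallelogram law at `f = ½(g + g')`, `h = ½(g − g')` (both window test functions, so
`J_λ(f) ≥ m`) and the coercivity `q_λ(h) ≥ (ε(a) − λ) ∫ |h|² = ¼ (ε(a) − λ) ∫ |g − g'|²`. In
Suzuki's language: `‖g − g'‖²_{T} = 2‖g − v₀‖²_T + 2‖g' − v₀‖²_T − 4‖½(g+g') − v₀‖²_T` and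
`‖·‖₂² ≤ (λ_a − λ)⁻¹ ‖·‖²_T`. [cite: Suzuki2026, §1.2 eq. (1.9)] -/
theorem integral_norm_sq_sub_le_of_le_weilResolventFunctional (hg : IsWeilTest g)
    (hgs : tsupport g ⊆ Icc (-a) a) (hg' : IsWeilTest g') (hg's : tsupport g' ⊆ Icc (-a) a)
    (hm : ∀ h : ℝ → ℂ, IsWeilTest h → tsupport h ⊆ Icc (-a) a →
      m ≤ weilResolventFunctional lam h) :
    (weilGroundEnergy a - lam) * ∫ t, ‖g t - g' t‖ ^ 2 ≤
      2 * (weilResolventFunctional lam g + weilResolventFunctional lam g' - 2 * m) := by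
  set f : ℝ → ℂ := fun x ↦ (1 / 2 : ℂ) * (g + g') x with hf
  set h : ℝ → ℂ := fun x ↦ (1 / 2 : ℂ) * (g - g') x with hh
  have hneg : IsWeilTest (-g') := by
    have h1 : IsWeilTest (fun t ↦ (-1 : ℂ) * g' t) := hg'.const_mul (-1)
    have e : (fun t ↦ (-1 : ℂ) * g' t) = -g' := by funext t; simp
    rwa [e] at h1
  have hsub : IsWeilTest (g - g') := by simpa [sub_eq_add_neg] using hg.add hneg
  have hft : IsWeilTest f := (hg.add hg').const_mul _
  have hht : IsWeilTest h := hsub.const_mul _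
  have hfs : tsupport f ⊆ Icc (-a) a :=
    tsupport_mul_subset_right.trans ((tsupport_add _ _).trans (union_subset hgs hg's))
  have hhs : tsupport h ⊆ Icc (-a) a := by
    refine tsupport_mul_subset_right.trans ?_
    rw [sub_eq_add_neg]
    refine (tsupport_add _ _).trans (union_subset hgs ?_)
    rw [tsupport_neg]
    exact hg's
  have e1 : f + h = g := by
    funext x; simp only [hf, hh, Pi.add_apply, Pi.sub_apply]; ring
  have e2 : f - h = g' := by
    funext x; simp only [hf, hh, Pi.add_apply, Pi.sub_apply]; ring
  have hpar := weilResolventFunctional_add_add_sub lam hft hht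
  rw [e1, e2] at hpar
  have hmf : m ≤ weilResolventFunctional lam f := hm f hft hfs
  have hcoer : weilGroundEnergy a * ∫ x, ‖h x‖ ^ 2 ≤ (weilQuadratic h).re :=
    weilGroundEnergy_mul_le_re hht hhs
  have hNh : ∫ x, ‖h x‖ ^ 2 = (1 / 4) * ∫ t, ‖g t - g' t‖ ^ 2 := by
    rw [← integral_const_mul]
    congr 1 with x
    simp only [hh, Pi.sub_apply, norm_mul, norm_div, norm_one, Complex.norm_ofNat, mul_pow]
    norm_num
  rw [hNh] at hcoer hpar
  have hN0 : 0 ≤ ∫ t, ‖g t - g' t‖ ^ 2 := integral_nonneg fun t ↦ by positivity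
  nlinarith [hcoer, hmf, hpar, hN0]

end Key

/-! ## §3. Uniqueness a.e. -/

namespace IsWeilResolventVector

variable {a lam : ℝ} {v w : ℝ → ℂ}

/-- **Uniqueness of the shifted-resolvent vector below the bottom.** For `λ < ε(a)` two
shifted-resolvent vectors on the same window agree a.e.: if `gₙ → v`, `g'ₙ → w` are minimising
sequences then `∫ |gₙ − g'ₙ|² ≤ 2(J(gₙ) + J(g'ₙ) − 2 inf J)/(ε(a) − λ) → 0` (key inequality),
so `‖v − w‖₂ ≤ ‖v − gₙ‖₂ + ‖gₙ − g'ₙ‖₂ + ‖g'ₙ − w‖₂ → 0` (uniqueness of the Riesz representer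
`(A_a − λ)⁻¹ 1` in `H(T_{a,λ})`, Kato VI §2.1). [cite: Kato1966, VI §2.1 Thm. 2.1 (proof)] -/
theorem ae_eq (hlam : lam < weilGroundEnergy a) (hv : IsWeilResolventVector a lam v)
    (hw : IsWeilResolventVector a lam w) : v =ᵐ[volume] w := by
  obtain ⟨g, hg, hJ, hL⟩ := hv.exists_tendsto_weilResolventInf
  obtain ⟨g', hg', hJ', hL'⟩ := hw.exists_tendsto_weilResolventInf
  set m := weilResolventInf a lam with hm
  set c := weilGroundEnergy a - lam with hc
  have hcpos : 0 < c := sub_pos.2 hlam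
  have hmle : ∀ h : ℝ → ℂ, IsWeilTest h → tsupport h ⊆ Icc (-a) a →
      m ≤ weilResolventFunctional lam h := fun h hh hhs ↦ hv.weilResolventInf_le hh hhs
  -- `∫ |gₙ - g'ₙ|² → 0`
  have hkey : ∀ n, ∫ t, ‖g n t - g' n t‖ ^ 2 ≤
      2 / c * (weilResolventFunctional lam (g n) + weilResolventFunctional lam (g' n) - 2 * m) := by
    intro n
    have h := integral_norm_sq_sub_le_of_le_weilResolventFunctional (hg n).1 (hg n).2 (hg' n).1
      (hg' n).2 hmle
    rw [div_mul_eq_mul_div, le_div_iff₀ hcpos]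
    linarith
  have hgg' : Tendsto (fun n ↦ ∫ t, ‖g n t - g' n t‖ ^ 2) atTop (𝓝 0) := by
    have hlim : Tendsto (fun n ↦ 2 / c * (weilResolventFunctional lam (g n) +
        weilResolventFunctional lam (g' n) - 2 * m)) atTop (𝓝 0) := by
      have := ((hJ.add hJ').sub_const (2 * m)).const_mul (2 / c)
      simpa [two_mul] using this
    exact squeeze_zero (fun n ↦ integral_nonneg fun t ↦ by positivity) hkey hlim
  -- triangle inequality in `L²`
  have hgm : ∀ n, MemLp (g n) 2 := fun n ↦ isWeilTest_memLp (hg n).1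
  have hg'm : ∀ n, MemLp (g' n) 2 := fun n ↦ isWeilTest_memLp (hg' n).1
  have htri : ∀ n, Real.sqrt (∫ t, ‖v t - w t‖ ^ 2) ≤
      Real.sqrt (∫ t, ‖g n t - v t‖ ^ 2) + Real.sqrt (∫ t, ‖g n t - g' n t‖ ^ 2) +
        Real.sqrt (∫ t, ‖g' n t - w t‖ ^ 2) := by
    intro n
    have h1 := sqrt_integral_norm_sq_sub_le (f := fun t ↦ v t - g n t) (h := fun t ↦ w t - g n t)
      (hv.memLp.sub (hgm n)) (hw.memLp.sub (hgm n))
    have h2 := sqrt_integral_norm_sq_sub_le (f := fun t ↦ g n t - g' n t)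
      (h := fun t ↦ w t - g' n t) ((hgm n).sub (hg'm n)) (hw.memLp.sub (hg'm n))
    have i1 : (∫ t, ‖v t - g n t - (w t - g n t)‖ ^ 2) = ∫ t, ‖v t - w t‖ ^ 2 := by
      congr 1 with t; rw [sub_sub_sub_cancel_right]
    have i2 : (∫ t, ‖v t - g n t‖ ^ 2) = ∫ t, ‖g n t - v t‖ ^ 2 := by
      congr 1 with t; rw [norm_sub_rev]
    have i3 : (∫ t, ‖w t - g n t‖ ^ 2) = ∫ t, ‖g n t - w t‖ ^ 2 := by
      congr 1 with t; rw [norm_sub_rev]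
    have i4 : (∫ t, ‖g n t - g' n t - (w t - g' n t)‖ ^ 2) = ∫ t, ‖g n t - w t‖ ^ 2 := by
      congr 1 with t; rw [sub_sub_sub_cancel_right]
    have i5 : (∫ t, ‖w t - g' n t‖ ^ 2) = ∫ t, ‖g' n t - w t‖ ^ 2 := by
      congr 1 with t; rw [norm_sub_rev]
    rw [i1, i2, i3] at h1
    rw [i4, i5] at h2
    linarith
  have hlim0 : Tendsto (fun n ↦ Real.sqrt (∫ t, ‖g n t - v t‖ ^ 2) +
      Real.sqrt (∫ t, ‖g n t - g' n t‖ ^ 2) + Real.sqrt (∫ t, ‖g' n t - w t‖ ^ 2)) atTop (𝓝 0) := by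
    have h := (hL.sqrt.add hgg'.sqrt).add hL'.sqrt
    simpa using h
  have hzero : Real.sqrt (∫ t, ‖v t - w t‖ ^ 2) = 0 :=
    le_antisymm (ge_of_tendsto' hlim0 htri) (Real.sqrt_nonneg _)
  have hvw : MemLp (fun t ↦ v t - w t) 2 := hv.memLp.sub hw.memLp
  have hint : Integrable fun t ↦ ‖v t - w t‖ ^ 2 := (memLp_two_iff_integrable_sq_norm hvw.1).1 hvw
  rw [Real.sqrt_eq_zero (integral_nonneg fun t ↦ by positivity)] at hzero
  have hae : (fun t ↦ ‖v t - w t‖ ^ 2) =ᵐ[volume] 0 :=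
    (integral_eq_zero_iff_of_nonneg (fun t ↦ by positivity) hint).1 hzero
  filter_upwards [hae] with t ht
  have : ‖v t - w t‖ = 0 := by simpa using ht
  exact sub_eq_zero.1 (norm_eq_zero.1 this)

end IsWeilResolventVector

/-! ## §4. Existence -/

section Existence

variable {a lam : ℝ} {g : ℝ → ℂ}

/-- **`J_λ` is bounded below on the window** for `λ < ε(a)`: with `c = ε(a) − λ > 0` and the
Cauchy–Schwarz constant `C` of the window at `s = 1/2` (`|ĝ(1/2)| ≤ C ‖g‖₂`,
`norm_weilMellin_le_of_ae_eq_zero`), `J_λ(g) ≥ c‖g‖₂² − 2C‖g‖₂ ≥ −C²/c` (the functional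
`g ↦ ⟨g, 1⟩` is bounded on `H(T_{a,λ})`, Kato VI §2.1). [cite: Kato1966, VI §2.1 Thm. 2.1 (proof)] -/
theorem bddBelow_weilResolventFunctional (hlam : lam < weilGroundEnergy a) :
    BddBelow {x : ℝ | ∃ h : ℝ → ℂ, IsWeilTest h ∧ tsupport h ⊆ Icc (-a) a ∧
      x = weilResolventFunctional lam h} := by
  set c := weilGroundEnergy a - lam with hc
  have hcpos : 0 < c := sub_pos.2 hlam
  set C := Real.sqrt (∫ t in Icc (-a) a, ‖cexp (((1 / 2 : ℂ) - 1 / 2) * t)‖ ^ 2) with hC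
  have hC0 : 0 ≤ C := Real.sqrt_nonneg _
  refine ⟨-(C ^ 2 / c), ?_⟩
  rintro x ⟨h, hh, hhs, rfl⟩
  set N := ∫ t, ‖h t‖ ^ 2 with hN
  have hN0 : 0 ≤ N := integral_nonneg fun t ↦ by positivity
  set y := Real.sqrt N with hy
  have hy0 : 0 ≤ y := Real.sqrt_nonneg _
  have hyN : y ^ 2 = N := Real.sq_sqrt hN0
  -- `|Re ĥ(1/2)| ≤ C y`
  have hhz : ∀ᵐ t : ℝ, t ∉ Icc (-a) a → h t = 0 :=
    Eventually.of_forall fun t ht ↦ image_eq_zero_of_notMem_tsupport fun h' ↦ ht (hhs h')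
  have hL : (weilMellin h (1 / 2)).re ≤ C * y :=
    (Complex.re_le_norm _).trans (norm_weilMellin_le_of_ae_eq_zero (isWeilTest_memLp hh) hhz _)
  -- coercivity `q_λ(h) ≥ c N`
  have hq : c * N ≤ (weilQuadratic h).re - lam * N := by
    have := weilGroundEnergy_mul_le_re hh hhs
    rw [hc]
    linarith
  have hsq : 0 ≤ c * y ^ 2 - 2 * C * y + C ^ 2 / c := by
    have h1 : c * (c * y ^ 2 - 2 * C * y + C ^ 2 / c) = (c * y - C) ^ 2 := by
      field_simp
      ring
    have h2 : 0 ≤ c * (c * y ^ 2 - 2 * C * y + C ^ 2 / c) := h1 ▸ sq_nonneg _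
    exact (mul_nonneg_iff_of_pos_left hcpos).1 h2
  show -(C ^ 2 / c) ≤ weilResolventFunctional lam h
  unfold weilResolventFunctional
  rw [← hN]
  rw [hyN] at hsq
  linarith

/-- **`L²(ℝ)` is complete**, in the language of `∫ |·|²`: an `L²`-Cauchy sequence of
square-integrable functions has an `L²`-limit (`MeasureTheory.Lp` is a complete space).
[folklore] -/
theorem exists_memLp_two_of_cauchy {g : ℕ → ℝ → ℂ} (hg : ∀ n, MemLp (g n) 2)
    (hC : ∀ δ > 0, ∃ N, ∀ n ≥ N, ∀ k ≥ N, ∫ t, ‖g n t - g k t‖ ^ 2 < δ) :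
    ∃ v : ℝ → ℂ, MemLp v 2 ∧ Tendsto (fun n ↦ ∫ t, ‖g n t - v t‖ ^ 2) atTop (𝓝 0) := by
  set G : ℕ → Lp ℂ 2 (volume : Measure ℝ) := fun n ↦ (hg n).toLp (g n) with hG
  have hdist : ∀ n k, dist (G n) (G k) = Real.sqrt (∫ t, ‖g n t - g k t‖ ^ 2) := by
    intro n k
    rw [dist_eq_norm]
    simp only [hG]
    rw [← MemLp.toLp_sub (hg n) (hg k), Lp.norm_toLp,
      eLpNorm_two_eq_ofReal_sqrt ((hg n).sub (hg k)), ENNReal.toReal_ofReal (Real.sqrt_nonneg _)]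
    rfl
  have hCauchy : CauchySeq G := by
    refine Metric.cauchySeq_iff.2 fun ε hε ↦ ?_
    obtain ⟨N, hN⟩ := hC (ε ^ 2) (by positivity)
    refine ⟨N, fun n hn k hk ↦ ?_⟩
    rw [hdist]
    calc Real.sqrt (∫ t, ‖g n t - g k t‖ ^ 2) < Real.sqrt (ε ^ 2) :=
          Real.sqrt_lt_sqrt (integral_nonneg fun t ↦ by positivity) (hN n hn k hk)
      _ = ε := Real.sqrt_sq hε.le
  obtain ⟨V, hV⟩ := cauchySeq_tendsto_of_complete hCauchy
  refine ⟨V, Lp.memLp V, ?_⟩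
  have hnorm : Tendsto (fun n ↦ ‖G n - V‖) atTop (𝓝 0) :=
    tendsto_iff_norm_sub_tendsto_zero.1 hV
  have heq : ∀ n, ‖G n - V‖ = Real.sqrt (∫ t, ‖g n t - V t‖ ^ 2) := by
    intro n
    have hae : (⇑(G n - V) : ℝ → ℂ) =ᵐ[volume] (g n - ⇑V : ℝ → ℂ) :=
      (Lp.coeFn_sub (G n) V).trans (((hg n).coeFn_toLp).sub EventuallyEq.rfl)
    rw [Lp.norm_def, eLpNorm_congr_ae hae, eLpNorm_two_eq_ofReal_sqrt ((hg n).sub (Lp.memLp V)),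
      ENNReal.toReal_ofReal (Real.sqrt_nonneg _)]
    rfl
  have hsqrt : Tendsto (fun n ↦ Real.sqrt (∫ t, ‖g n t - V t‖ ^ 2)) atTop (𝓝 0) :=
    hnorm.congr heq
  have h2 := hsqrt.pow 2
  rw [zero_pow two_ne_zero] at h2
  refine h2.congr fun n ↦ ?_
  exact Real.sq_sqrt (integral_nonneg fun t ↦ by positivity)

/-- **Existence of the shifted-resolvent vector below the bottom.** For every real `a` and every
`λ < ε(a)` there is a shifted-resolvent vector `v`, `IsWeilResolventVector a lam v`: take a
minimising sequence `gₙ` of window test functions for `J_λ` (`J_λ` is bounded below,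
`bddBelow_weilResolventFunctional`; the value set is nonempty, `J_λ(0) = 0`); by the key
inequality `(ε(a) − λ)∫|gₙ − g_k|² ≤ 2(J(gₙ) + J(g_k) − 2 inf J) → 0` it is `L²`-Cauchy, and
`L²` is complete. This is the existence of the Riesz representer `(A_a − λ)⁻¹ 1 ∈ H(T_{a,λ})`
of `g ↦ ⟨g, 1⟩` (Kato VI §2.1, proof of Thm. 2.1; Suzuki 2026 §1.2 (1.9)) together with
Bombieri's remark that minimising sequences converge strongly in `L²` (2000, §4 Thm. 3).
[cite: Kato1966, VI §2.1 Thm. 2.1 (proof)] -/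
theorem exists_isWeilResolventVector (hlam : lam < weilGroundEnergy a) :
    ∃ v : ℝ → ℂ, IsWeilResolventVector a lam v := by
  set S : Set ℝ := {x : ℝ | ∃ h : ℝ → ℂ, IsWeilTest h ∧ tsupport h ⊆ Icc (-a) a ∧
    x = weilResolventFunctional lam h} with hS
  have hne : S.Nonempty :=
    ⟨0, 0, isWeilTest_zero, by simp [tsupport_zero], (weilResolventFunctional_zero lam).symm⟩
  have hbdd : BddBelow S := bddBelow_weilResolventFunctional hlam
  set m := sInf S with hm
  have hmle : ∀ h : ℝ → ℂ, IsWeilTest h → tsupport h ⊆ Icc (-a) a →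
      m ≤ weilResolventFunctional lam h := fun h hh hhs ↦ csInf_le hbdd ⟨h, hh, hhs, rfl⟩
  obtain ⟨x, -, hx, hmem⟩ := exists_seq_tendsto_sInf hne hbdd
  have hmem' : ∀ n, ∃ h : ℝ → ℂ, IsWeilTest h ∧ tsupport h ⊆ Icc (-a) a ∧
      x n = weilResolventFunctional lam h := hmem
  choose g hg hgs hxg using hmem'
  have hJ : Tendsto (fun n ↦ weilResolventFunctional lam (g n)) atTop (𝓝 m) := by
    have e : (fun n ↦ weilResolventFunctional lam (g n)) = x := funext fun n ↦ (hxg n).symm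
    rw [e]
    exact hx
  -- the minimising sequence is `L²`-Cauchy
  set c := weilGroundEnergy a - lam with hc
  have hcpos : 0 < c := sub_pos.2 hlam
  have hC : ∀ δ > 0, ∃ N, ∀ n ≥ N, ∀ k ≥ N, ∫ t, ‖g n t - g k t‖ ^ 2 < δ := by
    intro δ hδ
    have hη : 0 < δ * c / 4 := by positivity
    obtain ⟨N, hN⟩ := eventually_atTop.1 (hJ.eventually (gt_mem_nhds (show m < m + δ * c / 4 by
      linarith)))
    refine ⟨N, fun n hn k hk ↦ ?_⟩
    have hkey := integral_norm_sq_sub_le_of_le_weilResolventFunctional (hg n) (hgs n) (hg k)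
      (hgs k) hmle
    have h1 := hN n hn
    have h2 := hN k hk
    by_contra hcon
    rw [not_lt] at hcon
    nlinarith [hkey, h1, h2, hcon, hcpos]
  obtain ⟨v, hv, hL⟩ := exists_memLp_two_of_cauchy (fun n ↦ isWeilTest_memLp (hg n)) hC
  exact ⟨v, hv, g, fun n ↦ ⟨hg n, hgs n⟩, ⟨m, hmle, hJ⟩, hL⟩

/-- For `λ < ε(a)` the bottom `weilResolventInf a lam` is a genuine infimum: a lower bound of
`J_λ` on the window. [folklore] -/
theorem weilResolventInf_le_weilResolventFunctional (hlam : lam < weilGroundEnergy a)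
    (hg : IsWeilTest g) (hgs : tsupport g ⊆ Icc (-a) a) :
    weilResolventInf a lam ≤ weilResolventFunctional lam g :=
  csInf_le (bddBelow_weilResolventFunctional hlam) ⟨g, hg, hgs, rfl⟩

end Existence


/-! ## §5. The value at `1/2`: `Re v̂(1/2) = −inf J_λ > 0` -/

namespace IsWeilResolventVector

variable {a lam : ℝ} {v : ℝ → ℂ}

/-- **`ĝₙ(s) → v̂(s)` along the minimising sequence** (Cauchy–Schwarz on the window: `v` and the
`gₙ` vanish off `[-a, a]`). [folklore] -/
theorem tendsto_weilMellin (hv : IsWeilResolventVector a lam v) {gs : ℕ → ℝ → ℂ}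
    (hgs : ∀ n, IsWeilTest (gs n) ∧ tsupport (gs n) ⊆ Icc (-a) a)
    (hL2 : Tendsto (fun n ↦ ∫ t, ‖gs n t - v t‖ ^ 2) atTop (𝓝 0)) (s : ℂ) :
    Tendsto (fun n ↦ weilMellin (gs n) s) atTop (𝓝 (weilMellin v s)) := by
  rw [tendsto_iff_norm_sub_tendsto_zero]
  set C := √(∫ t in Icc (-a) a, ‖cexp ((s - 1 / 2) * t)‖ ^ 2) with hC
  have hbound : ∀ n, ‖weilMellin (gs n) s - weilMellin v s‖ ≤ C * √(∫ t, ‖gs n t - v t‖ ^ 2) := by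
    intro n
    have hsub : weilMellin (gs n) s - weilMellin v s = weilMellin (fun t ↦ gs n t - v t) s := by
      unfold weilMellin
      rw [← integral_sub (integrable_weilIntegrand (hgs n).1.1.continuous (hgs n).1.2 s)
        (hv.integrable_mul_cexp (s - 1 / 2))]
      congr 1 with t
      ring
    rw [hsub]
    refine norm_weilMellin_le_of_ae_eq_zero ((isWeilTest_memLp (hgs n).1).sub hv.memLp) ?_ s
    filter_upwards [hv.ae_eq_zero_of_notMem] with t ht hts
    have h1 : gs n t = 0 := image_eq_zero_of_notMem_tsupport fun h' ↦ hts ((hgs n).2 h')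
    simp [h1, ht hts]
  refine squeeze_zero (fun _ ↦ norm_nonneg _) hbound ?_
  have h := hL2.sqrt
  rw [Real.sqrt_zero] at h
  simpa using h.const_mul C

/-- **The value at `1/2`.** For `λ < ε(a)` and a shifted-resolvent vector `v`,
`Re v̂(1/2) = −weilResolventInf a λ` — in operator language `⟨(A_a − λ)⁻¹ 1, 1⟩ = ‖v‖²_T =
−min J_λ`. Proof (Euler–Lagrange along the minimising sequence `gₙ → v`): `Re ĝₙ(1/2) → Re v̂(1/2)
=: ℓ`, `q_λ(gₙ) = J(gₙ) + 2 Re ĝₙ(1/2) → m + 2ℓ`, and `J(t gₙ) = t² q_λ(gₙ) − 2t Re ĝₙ(1/2) ≥ m`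
for all real `t`; in the limit the quadratic `t ↦ t²(m + 2ℓ) − 2tℓ − m ≥ 0` vanishes at `t = 1`,
so its derivative there, `2(m + ℓ)`, is zero. (Kato VI §2.1: `(u, v) = (u′, v)_t` with `v = u′`.)
[cite: Kato1966, VI §2.1 Thm. 2.1 (proof)] -/
theorem re_weilMellin_half (hv : IsWeilResolventVector a lam v) :
    (weilMellin v (1 / 2)).re = -weilResolventInf a lam := by
  obtain ⟨g, hg, hJ, hL⟩ := hv.exists_tendsto_weilResolventInf
  set m := weilResolventInf a lam with hm
  set ℓ := (weilMellin v (1 / 2)).re with hℓ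
  have hmle : ∀ h : ℝ → ℂ, IsWeilTest h → tsupport h ⊆ Icc (-a) a →
      m ≤ weilResolventFunctional lam h := fun h hh hhs ↦ hv.weilResolventInf_le hh hhs
  -- (i) `Re ĝₙ(1/2) → ℓ`
  have hLn : Tendsto (fun n ↦ (weilMellin (g n) (1 / 2)).re) atTop (𝓝 ℓ) :=
    (Complex.continuous_re.tendsto _).comp (hv.tendsto_weilMellin hg hL (1 / 2))
  -- (ii) `q_λ(gₙ) → m + 2ℓ`
  set q : ℕ → ℝ := fun n ↦ (weilQuadratic (g n)).re - lam * ∫ t, ‖g n t‖ ^ 2 with hq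
  have hq_eq : ∀ n, q n = weilResolventFunctional lam (g n) + 2 * (weilMellin (g n) (1 / 2)).re := by
    intro n
    simp only [hq, weilResolventFunctional]
    ring
  have hqlim : Tendsto q atTop (𝓝 (m + 2 * ℓ)) := by
    have h := hJ.add (hLn.const_mul 2)
    exact h.congr' (Eventually.of_forall fun n ↦ (hq_eq n).symm)
  -- (iii) `J(t gₙ) ≥ m` along real rays, and its limit
  have hray : ∀ (t : ℝ) (n : ℕ), m ≤ t ^ 2 * q n - 2 * t * (weilMellin (g n) (1 / 2)).re := by
    intro t n
    have h := hmle (fun x ↦ (t : ℂ) * g n x) ((hg n).1.const_mul t)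
      (tsupport_mul_subset_right.trans (hg n).2)
    rwa [weilResolventFunctional_real_mul] at h
  have hlim : ∀ t : ℝ, m ≤ t ^ 2 * (m + 2 * ℓ) - 2 * t * ℓ := fun t ↦
    ge_of_tendsto' ((hqlim.const_mul (t ^ 2)).sub (hLn.const_mul (2 * t))) (hray t)
  -- (iv) the quadratic `s ↦ (m + 2ℓ) s² + 2(m + ℓ) s ≥ 0` (put `t = 1 + s`) has zero discriminant
  have hnonneg : ∀ s : ℝ, 0 ≤ (m + 2 * ℓ) * (s * s) + 2 * (m + ℓ) * s + 0 := by
    intro s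
    have h := hlim (1 + s)
    nlinarith [h]
  have hdisc := discrim_le_zero hnonneg
  rw [discrim] at hdisc
  have hsq : (m + ℓ) ^ 2 ≤ 0 := by nlinarith [hdisc]
  have hzero : m + ℓ = 0 := by
    have := le_antisymm hsq (sq_nonneg _)
    exact pow_eq_zero_iff two_ne_zero |>.1 this
  linarith

end IsWeilResolventVector

section Positivity

variable {a lam : ℝ} {v : ℝ → ℂ}

/-- **The bottom of `J_λ` is negative** on a genuine window: for `a > 0`, as soon as `J_λ` is
bounded below on the window (e.g. `λ < ε(a)`, or a shifted-resolvent vector exists),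
`weilResolventInf a λ < 0`. Take a window test function `h` with `ĥ(1/2) ≠ 0`
(`exists_isWeilTest_weilMellin_ne_zero`), turn its phase so that `Re ĥ(1/2) = |ĥ(1/2)| > 0`, and
scale: `J_λ(t h) = t² q_λ(h) − 2t |ĥ(1/2)| < 0` for small `t > 0`. (`⟨T⁻¹1, 1⟩ > 0` since
`1 ≠ 0` in `H(T)'`.) [folklore] -/
theorem weilResolventInf_neg_of_bddBelow (ha : 0 < a)
    (hbdd : BddBelow {x : ℝ | ∃ h : ℝ → ℂ, IsWeilTest h ∧ tsupport h ⊆ Icc (-a) a ∧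
      x = weilResolventFunctional lam h}) :
    weilResolventInf a lam < 0 := by
  obtain ⟨h, hh, hhs, hne⟩ := exists_isWeilTest_weilMellin_ne_zero ha (1 / 2)
  set z := weilMellin h (1 / 2) with hz
  have hzpos : 0 < ‖z‖ := norm_pos_iff.2 hne
  set c : ℂ := conj z / (‖z‖ : ℂ) with hc
  set h' : ℝ → ℂ := fun x ↦ c * h x with hh'
  have hh't : IsWeilTest h' := hh.const_mul c
  have hh's : tsupport h' ⊆ Icc (-a) a := tsupport_mul_subset_right.trans hhs
  have hL' : (weilMellin h' (1 / 2)).re = ‖z‖ := by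
    have hz0 : (‖z‖ : ℂ) ≠ 0 := by exact_mod_cast hzpos.ne'
    have hcz : c * z = (‖z‖ : ℂ) := by
      rw [hc, div_mul_eq_mul_div, mul_comm, Complex.mul_conj, Complex.normSq_eq_norm_sq,
        Complex.ofReal_pow, sq, mul_div_assoc, div_self hz0, mul_one]
    rw [hh', weilMellin_const_mul, ← hz, hcz, Complex.ofReal_re]
  set qh : ℝ := (weilQuadratic h').re - lam * ∫ x, ‖h' x‖ ^ 2 with hqh
  set t : ℝ := ‖z‖ / (|qh| + ‖z‖) with ht
  have hden : 0 < |qh| + ‖z‖ := by positivity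
  have htpos : 0 < t := div_pos hzpos hden
  have htq : t * qh < ‖z‖ := by
    have h1 : t * qh ≤ t * |qh| := mul_le_mul_of_nonneg_left (le_abs_self _) htpos.le
    have h2 : t * |qh| < ‖z‖ := by
      rw [ht, div_mul_eq_mul_div, div_lt_iff₀ hden]
      nlinarith [abs_nonneg qh, hzpos]
    linarith
  have hval : weilResolventFunctional lam (fun x ↦ (t : ℂ) * h' x) = t ^ 2 * qh - 2 * t * ‖z‖ := by
    rw [weilResolventFunctional_real_mul, hL']
  have hneg : weilResolventFunctional lam (fun x ↦ (t : ℂ) * h' x) < 0 := by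
    rw [hval]
    nlinarith [htq, htpos]
  exact (csInf_le hbdd ⟨_, hh't.const_mul t, tsupport_mul_subset_right.trans hh's, rfl⟩).trans_lt
    hneg

/-- For `a > 0` and `λ < ε(a)`: `weilResolventInf a λ < 0`. [folklore] -/
theorem weilResolventInf_neg (ha : 0 < a) (hlam : lam < weilGroundEnergy a) :
    weilResolventInf a lam < 0 :=
  weilResolventInf_neg_of_bddBelow ha (bddBelow_weilResolventFunctional hlam)

/-- **Positivity of the value at `1/2`.** For `a > 0` and a shifted-resolvent vector `v` (any
shift for which one exists, e.g. every `λ < ε(a)`): `0 < Re v̂(1/2)`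
(`= ⟨(A_a − λ)⁻¹ 1, 1⟩ = −min J_λ > 0`). [folklore] -/
theorem IsWeilResolventVector.re_weilMellin_half_pos (ha : 0 < a)
    (hv : IsWeilResolventVector a lam v) : 0 < (weilMellin v (1 / 2)).re := by
  rw [hv.re_weilMellin_half]
  linarith [weilResolventInf_neg_of_bddBelow ha hv.bddBelow]

end Positivity


/-! ## §6. Parity and conjugation invariance of `W`, `Q`, `J_λ` (parity: private copies of `WeilWindowSimpleEven.lean` API) -/

namespace WeilResolvent

section Reflection

variable (g h k : ℝ → ℂ)

/-- Reflection commutes with convolution: `(g(-·)) ⋆ (h(-·)) = (g ⋆ h)(-·)`. Copy of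
`weilConv_comp_neg`. [folklore] -/
private theorem weilConv_comp_neg :
    weilConv (fun t ↦ g (-t)) (fun t ↦ h (-t)) = fun t ↦ weilConv g h (-t) := by
  funext t
  rw [weilConv_apply, weilConv_apply,
    ← integral_neg_eq_self (fun u : ℝ ↦ g u * h (-t - u)) volume]
  congr 1 with u
  rw [show -(t - u) = -t - -u by ring]

/-- Reflection commutes with the involution (definitional). [folklore] -/
private theorem weilReflect_comp_neg :
    weilReflect (fun t ↦ g (-t)) = fun t ↦ weilReflect g (-t) := rfl

/-- The polar term is reflection invariant. [folklore] -/
private theorem weilPolarTerm_comp_neg : weilPolarTerm (fun t ↦ k (-t)) = weilPolarTerm k := by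
  rw [weilPolarTerm, weilPolarTerm, weilMellin_comp_neg, weilMellin_comp_neg, sub_zero, sub_self,
    add_comm]

/-- The prime term is reflection invariant. [folklore] -/
private theorem weilPrimeTerm_comp_neg : weilPrimeTerm (fun t ↦ k (-t)) = weilPrimeTerm k := by
  unfold weilPrimeTerm
  refine tsum_congr fun n ↦ ?_
  dsimp only
  rw [neg_neg, add_comm (k (-Real.log n))]

/-- The archimedean integral is reflection invariant (`Re ψ(1/4 + it/2)` is even in `t`). [folklore] -/
private theorem weilArchIntegral_comp_neg :
    weilArchIntegral (fun t ↦ k (-t)) = weilArchIntegral k := by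
  unfold weilArchIntegral
  rw [← integral_neg_eq_self (fun t : ℝ ↦ weilMellin k (1 / 2 + t * I) *
    ((Complex.digamma (1 / 4 + t / 2 * I)).re : ℂ)) volume]
  congr 1 with t
  rw [weilMellin_comp_neg, quarter_add_neg_mul_I, digamma_conj, Complex.conj_re]
  congr 2
  push_cast
  ring

/-- The archimedean term is reflection invariant. [folklore] -/
private theorem weilArchTerm_comp_neg : weilArchTerm (fun t ↦ k (-t)) = weilArchTerm k := by
  rw [weilArchTerm, weilArchTerm, weilArchIntegral_comp_neg, neg_zero]

/-- **Parity invariance of the Weil functional** `W(k(-·)) = W(k)`, hypothesis-free. Copy of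
`weilFunctional_comp_neg`. [folklore] -/
private theorem weilFunctional_comp_neg : weilFunctional (fun t ↦ k (-t)) = weilFunctional k := by
  rw [weilFunctional, weilFunctional, weilPolarTerm_comp_neg, weilPrimeTerm_comp_neg,
    weilArchTerm_comp_neg]

/-- **Parity invariance of `Q`**: `Q(g(-·)) = Q(g)`, hypothesis-free. Copy of
`weilQuadratic_comp_neg`. [folklore] -/
private theorem weilQuadratic_comp_neg : weilQuadratic (fun t ↦ g (-t)) = weilQuadratic g := by
  unfold weilQuadratic
  rw [weilReflect_comp_neg, weilConv_comp_neg, weilFunctional_comp_neg]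

end Reflection

end WeilResolvent

open WeilResolvent



section Conjugation

variable (lam : ℝ) (g : ℝ → ℂ)

/-- **The kernel of `ḡ` is the reflected kernel of `g`**: `ḡ ⋆ (ḡ)̃ = (g ⋆ g̃)(−·)`, since
`(ḡ ⋆ (ḡ)̃)(t) = ∫ ḡ(u) g(u − t) du = conj (g ⋆ g̃)(t)` and the kernel `k = g ⋆ g̃` is
self-adjoint, `conj k(t) = k(−t)` (`conj_weilConv_weilReflect_neg`). No hypotheses. [folklore] -/
theorem weilConv_weilReflect_conj :
    weilConv (fun t ↦ conj (g t)) (weilReflect fun t ↦ conj (g t)) =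
      fun t ↦ weilConv g (weilReflect g) (-t) := by
  funext t
  have h1 : weilConv g (weilReflect g) (-t) = conj (weilConv g (weilReflect g) t) := by
    have h := conj_weilConv_weilReflect_neg g (-t)
    rw [neg_neg] at h
    exact h.symm
  rw [h1, weilConv_apply, weilConv_apply, ← integral_conj]
  congr 1 with u
  simp only [weilReflect, map_mul, Complex.conj_conj]

/-- **Conjugation invariance of Weil's quadratic functional**: `Q(ḡ) = Q(g)` for every
`g : ℝ → ℂ` (Weil's distribution is real and even: `ḡ ⋆ (ḡ)̃ = (g ⋆ g̃)(−·)` and `W` is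
reflection invariant). Hypothesis-free. [folklore] -/
theorem weilQuadratic_conj : weilQuadratic (fun t ↦ conj (g t)) = weilQuadratic g := by
  unfold weilQuadratic
  rw [weilConv_weilReflect_conj, weilFunctional_comp_neg]

/-- `ĝ(1/2) = ∫ g`, so `(ḡ)^(1/2) = conj ĝ(1/2)`. [folklore] -/
theorem weilMellin_conj_half : weilMellin (fun t ↦ conj (g t)) (1 / 2) = conj (weilMellin g (1 / 2)) := by
  have h : ∀ f : ℝ → ℂ, weilMellin f (1 / 2) = ∫ t, f t := fun f ↦ by simp [weilMellin]
  rw [h, h, integral_conj]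

/-- **`J_λ(ḡ) = J_λ(g)`**: the Dirichlet functional is conjugation invariant (`Q(ḡ) = Q(g)`,
`‖ḡ‖₂ = ‖g‖₂`, `Re conj ĝ(1/2) = Re ĝ(1/2)`). [folklore] -/
theorem weilResolventFunctional_conj :
    weilResolventFunctional lam (fun t ↦ conj (g t)) = weilResolventFunctional lam g := by
  simp only [weilResolventFunctional, weilQuadratic_conj, weilMellin_conj_half, Complex.conj_re,
    Complex.norm_conj]

/-- **`J_λ(g(−·)) = J_λ(g)`**: the Dirichlet functional is reflection invariant (`Q(g(−·)) = Q(g)`,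
`‖g(−·)‖₂ = ‖g‖₂`, `(g(−·))^(1/2) = ĝ(1 − 1/2) = ĝ(1/2)`). [folklore] -/
theorem weilResolventFunctional_comp_neg :
    weilResolventFunctional lam (fun t ↦ g (-t)) = weilResolventFunctional lam g := by
  simp only [weilResolventFunctional, weilQuadratic_comp_neg, weilMellin_comp_neg]
  rw [integral_neg_eq_self (fun t ↦ ‖g t‖ ^ 2) volume]
  norm_num

/-- Conjugation preserves test functions. [folklore] -/
theorem isWeilTest_conj {g : ℝ → ℂ} (hg : IsWeilTest g) : IsWeilTest fun t ↦ conj (g t) :=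
  ⟨Complex.conjCLE.contDiff.comp hg.1, hg.2.comp_left (map_zero _)⟩

end Conjugation

/-! ## §7. The symmetries of shifted-resolvent vectors; a real even representative -/

namespace IsWeilResolventVector

variable {a lam : ℝ} {v : ℝ → ℂ}

/-- **Reflection symmetry**: if `v` is a shifted-resolvent vector on the symmetric window
`[-a, a]`, so is `v(−·)` (reflect the minimising sequence; `J_λ` and `‖·‖₂` are reflection
invariant). [folklore] -/
theorem comp_neg (hv : IsWeilResolventVector a lam v) :
    IsWeilResolventVector a lam (fun t ↦ v (-t)) := by
  obtain ⟨hvm, g, hg, ⟨m, hm, hJ⟩, hL⟩ := hv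
  refine ⟨hvm.comp_measurePreserving (Measure.measurePreserving_neg (volume : Measure ℝ)),
    fun n t ↦ g n (-t), fun n ↦ ⟨(hg n).1.comp_neg, tsupport_comp_neg_subset (hg n).2⟩,
    ⟨m, hm, ?_⟩, ?_⟩
  · have hJ' : Tendsto (fun n ↦ weilResolventFunctional lam (g n)) atTop (𝓝 m) := hJ
    show Tendsto (fun n ↦ weilResolventFunctional lam (fun t ↦ g n (-t))) atTop (𝓝 m)
    simpa only [weilResolventFunctional_comp_neg] using hJ'
  · have he : ∀ n, ∫ t, ‖g n (-t) - v (-t)‖ ^ 2 = ∫ t, ‖g n t - v t‖ ^ 2 := fun n ↦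
      integral_neg_eq_self (fun t ↦ ‖g n t - v t‖ ^ 2) volume
    simpa only [he] using hL

/-- **Conjugation symmetry**: if `v` is a shifted-resolvent vector, so is `v̄` (conjugate the
minimising sequence; `J_λ` and `‖·‖₂` are conjugation invariant). [folklore] -/
theorem conj_comp (hv : IsWeilResolventVector a lam v) :
    IsWeilResolventVector a lam (fun t ↦ conj (v t)) := by
  obtain ⟨hvm, g, hg, ⟨m, hm, hJ⟩, hL⟩ := hv
  refine ⟨memLp_conj hvm, fun n t ↦ conj (g n t),
    fun n ↦ ⟨isWeilTest_conj (hg n).1,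
      (tsupport_comp_subset (map_zero (starRingEnd ℂ)) (g n)).trans (hg n).2⟩,
    ⟨m, hm, ?_⟩, ?_⟩
  · have hJ' : Tendsto (fun n ↦ weilResolventFunctional lam (g n)) atTop (𝓝 m) := hJ
    show Tendsto (fun n ↦ weilResolventFunctional lam (fun t ↦ conj (g n t))) atTop (𝓝 m)
    simpa only [weilResolventFunctional_conj] using hJ'
  · have he : ∀ n, ∫ t, ‖conj (g n t) - conj (v t)‖ ^ 2 = ∫ t, ‖g n t - v t‖ ^ 2 := fun n ↦ by
      congr 1 with t
      rw [← map_sub, Complex.norm_conj]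
    simpa only [he] using hL

/-- Below the bottom a shifted-resolvent vector is **a.e. even**. [folklore] -/
theorem ae_eq_comp_neg (hlam : lam < weilGroundEnergy a) (hv : IsWeilResolventVector a lam v) :
    v =ᵐ[volume] fun t ↦ v (-t) :=
  hv.ae_eq hlam hv.comp_neg

/-- Below the bottom a shifted-resolvent vector is **a.e. real**. [folklore] -/
theorem ae_eq_conj (hlam : lam < weilGroundEnergy a) (hv : IsWeilResolventVector a lam v) :
    v =ᵐ[volume] fun t ↦ conj (v t) :=
  hv.ae_eq hlam hv.conj_comp

end IsWeilResolventVector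

/-- **A real, even shifted-resolvent vector exists.** For every real `a` and `λ < ε(a)` there is
a shifted-resolvent vector `v` which is pointwise real-valued and even: average any
shifted-resolvent vector `v₀` (`exists_isWeilResolventVector`) to
`v(t) = ½(Re v₀(t) + Re v₀(−t))`, which agrees with `v₀` a.e. (`ae_eq_conj`, `ae_eq_comp_neg`)
and hence is again a shifted-resolvent vector (`congr_ae`). In operator language:
`(A_a − λ)⁻¹ 1_{[-a,a]}` is real and even because `A_a` commutes with conjugation and reflection
and the datum is real and even. [folklore] -/
theorem exists_isWeilResolventVector_real_even {a lam : ℝ} (hlam : lam < weilGroundEnergy a) :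
    ∃ v : ℝ → ℂ, IsWeilResolventVector a lam v ∧ ∀ t, (v t).im = 0 ∧ v (-t) = v t := by
  obtain ⟨v, hv⟩ := exists_isWeilResolventVector hlam
  refine ⟨fun t ↦ ((((v t).re + (v (-t)).re) / 2 : ℝ) : ℂ), hv.congr_ae ?_,
    fun t ↦ ⟨Complex.ofReal_im _, by beta_reduce; rw [neg_neg, add_comm]⟩⟩
  filter_upwards [hv.ae_eq_comp_neg hlam, hv.ae_eq_conj hlam] with t h1 h2
  have him : (v t).im = 0 := by
    have h := congrArg Complex.im h2
    simp only [Complex.conj_im] at h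
    linarith
  apply Complex.ext
  · simp only [Complex.ofReal_re, ← h1, add_self_div_two]
  · simp only [Complex.ofReal_im, him]

/-- **The shifted-resolvent vector, packaged** (the shape of route item `ResolventVectorExists` of
`RiemannHypothesis/ShiftedResolvent`, correctly parenthesised): for `a > 0` and `λ < ε(a)` there
is a real-valued, even shifted-resolvent vector `v` with `0 < Re v̂(1/2)`
(`exists_isWeilResolventVector_real_even`, `IsWeilResolventVector.re_weilMellin_half_pos`).
[folklore] -/
theorem exists_isWeilResolventVector_real_even_pos {a lam : ℝ} (ha : 0 < a)
    (hlam : lam < weilGroundEnergy a) :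
    ∃ v : ℝ → ℂ, IsWeilResolventVector a lam v ∧ (∀ t, (v t).im = 0 ∧ v (-t) = v t) ∧
      0 < (weilMellin v (1 / 2)).re := by
  obtain ⟨v, hv, hsym⟩ := exists_isWeilResolventVector_real_even hlam
  exact ⟨v, hv, hsym, hv.re_weilMellin_half_pos ha⟩

end Literature.NumberTheory.LFunctions

end
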